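import Summits.AnomalousDissipation.AnomalousDissipation.Theorems.SawtoothPulseCascadeK1LocalisedCascadeSymbolSocketH
import Summits.AnomalousDissipation.AnomalousDissipation.Theorems.SawtoothPulseCascadeK1LocalisedCascadeSymbolFibreDataV

/-!
# K1loc, line `Spectral` / SeqCone — helper: THE SYMBOL SOCKET OF THE V HALF-STEP AT ORDER `r = 1` (S-B assembly, V side)

Helper file of the prover lane on the crux `K1LocalisedCascade` (stmt-AnomalousDissipation-19491), route
`SawtoothPulseCascade` (S-B/S-C assembly seat; V-side companion of ad-k1loc-p3's `…SymbolSocketH`).  On the V half-slot of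
phase `j` the fibres are `k_v = n′`, the fibre coordinate is `t = k_h`, the shifts act along `e_h`; the OLD symbol is the
mid-phase product symbol `m̂ = 1 − g^M_{L₀}·g^env_{R,w}` and the NEW symbol is the next start-of-phase product symbol
`μ̂′ = 1 − g^S_{L}·g^env_{R′,w′}` (concrete indicators of `…SymbolLattice`).  The sharp V capstone
`…K1Ledger.cascade_ledger_step_V'` takes, on the symbol side, (i) fibre profiles `Mμ n′` of the old symbol, `ContDiff ℝ 1`,
bounded by `1`, `|Mμ′| ≤ C/b` (`hMμc/hμM/hCμ`), (ii) shifted squared fibre profiles `Np n′, Nm n′` of the new symbol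
(`hNpc/hmNp/hCNp`, …), (iii) lattice moduli along the `e_h`-axis (`hω0/hω/hω20/hω2` via
`…SpectralMoments.modulus_of_fibre_lipschitz` with `j := 0`), (iv) `hone` on fibres beyond the envelope.  This file supplies
exactly these data with ABSOLUTE constants at a common scale `b` (`b ≤ εL₀`, `b(γ² + a₂) ≤ ε_aL₀`, `b ≤ w` for the old symbol;
`b ≤ εL`, `b·a ≤ ε_aL`, `b ≤ w′` for the new one): `exists_fibre_data_symProdM_V` (i), `exists_fibre_data_symProdS_V_sq` +
`symProdS_sub_single_zero_sq_eq` (ii), `exists_lipschitz_axis_symProdM_V` / `exists_lipschitz_axis_symProdS_V_sq` (iii),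
`symProd_eq_one_of_le_abs_V` (iv), `symProdM_fibre_eq_V`.  No definitions; no statement about the stub.
[cite: Grafakos2014, Prop. 3.1.2 (5)] [problem: turb]
-/

-- `Summit.<Summit>.<Problem>`: single-conjunct summit, the duplicate namespace segment is deliberate.
set_option linter.dupNamespace false

noncomputable section

namespace Summit.AnomalousDissipation.AnomalousDissipation.Theorems.SawtoothPulseCascade.K1Symbol

open Set Filter Topology Real
open scoped ContDiff
open Summit.AnomalousDissipation.AnomalousDissipation.Theorems.SawtoothPulseCascade.K1Cutoff
open Summit.AnomalousDissipation.AnomalousDissipation.Theorems.SawtoothPulseCascade.K1Slot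

/-! ## Lattice bookkeeping along the `e_h`-axis -/

/-- Components of `k − q` for `q` on the `e_h`-axis of `ℤ²`. [folklore] -/
theorem sub_apply_of_axis_zero (k q : Fin 2 → ℤ) (hq : ∀ l : Fin 2, l ≠ 0 → q l = 0) :
    (k - q) 1 = k 1 ∧ (((k - q) 0 : ℤ) : ℝ) = (k 0 : ℝ) - (q 0 : ℝ) := by
  refine ⟨?_, ?_⟩
  · rw [Pi.sub_apply, hq 1 (by decide), sub_zero]
  · rw [Pi.sub_apply]; push_cast; ring

/-- **`hone` on the V half-slot**: beyond the envelope (`R + w ≤ |k_v|`, `w > 0`) the tracked product symbol is `1` on the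
whole fibre `k_v = n′` (the second envelope factor vanishes). [cite: ElgindiLissMattingly2025, §1.2.2 (the cocycle A(r,s))] -/
theorem symProd_eq_one_of_le_abs_V {R w : ℝ} (hw : 0 < w) (g : ℤ → ℤ → ℝ) {n' : ℤ} (hn : R + w ≤ |(n' : ℝ)|)
    (kh kv : ℤ) (hk : kv = n') :
    1 - g kh kv * ((1 - smoothTransition ((|(kh : ℝ)| - R) / w)) * (1 - smoothTransition ((|(kv : ℝ)| - R) / w))) = 1 := by
  refine one_sub_prod_eq_one_of_right_eq_zero (g₁ := g)
    (g₂ := fun kh kv => (1 - smoothTransition ((|(kh : ℝ)| - R) / w)) * (1 - smoothTransition ((|(kv : ℝ)| - R) / w))) ?_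
  by_contra h
  have h1 := (symEnv_supp hw kh kv h).2
  rw [hk] at h1
  linarith

/-! ## The three factors along a V-fibre: values in `[0,1]` and first-derivative bounds at scale `b` -/

/-- The V-fibre mid-phase factor `g^M(t, n′)` takes values in `[0,1]`. [folklore] -/
theorem midFactorV_mem (γ ε εa a₂ L₀ : ℝ) (n' : ℤ) (t : ℝ) :
    0 ≤ smoothTransition ((|t| - L₀) / (ε * L₀)) *
        (1 - smoothTransition ((γ * |(n' : ℝ) + γ * t| - a₂ * |t|) / (εa * L₀)) *
          smoothTransition ((γ * |(n' : ℝ) - γ * t| - a₂ * |t|) / (εa * L₀))) ∧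
    smoothTransition ((|t| - L₀) / (ε * L₀)) *
        (1 - smoothTransition ((γ * |(n' : ℝ) + γ * t| - a₂ * |t|) / (εa * L₀)) *
          smoothTransition ((γ * |(n' : ℝ) - γ * t| - a₂ * |t|) / (εa * L₀))) ≤ 1 :=
  ⟨mul_nonneg (Real.smoothTransition.nonneg _) (sub_nonneg.mpr (mul_le_one₀ (Real.smoothTransition.le_one _)
      (Real.smoothTransition.nonneg _) (Real.smoothTransition.le_one _))),
    mul_le_one₀ (Real.smoothTransition.le_one _) (sub_nonneg.mpr (mul_le_one₀ (Real.smoothTransition.le_one _)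
      (Real.smoothTransition.nonneg _) (Real.smoothTransition.le_one _)))
      (sub_le_self _ (mul_nonneg (Real.smoothTransition.nonneg _) (Real.smoothTransition.nonneg _)))⟩

/-- The (shifted) V-fibre envelope factor `g^env(t − t₀, n′)` takes values in `[0,1]`. [folklore] -/
theorem envFactorV_mem (R w : ℝ) (n' : ℤ) (t₀ t : ℝ) :
    0 ≤ (1 - smoothTransition ((|t - t₀| - R) / w)) * (1 - smoothTransition ((|(n' : ℝ)| - R) / w)) ∧
    (1 - smoothTransition ((|t - t₀| - R) / w)) * (1 - smoothTransition ((|(n' : ℝ)| - R) / w)) ≤ 1 :=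
  ⟨mul_nonneg (sub_nonneg.mpr (Real.smoothTransition.le_one _)) (sub_nonneg.mpr (Real.smoothTransition.le_one _)),
    mul_le_one₀ (sub_le_self _ (Real.smoothTransition.nonneg _)) (sub_nonneg.mpr (Real.smoothTransition.le_one _))
      (sub_le_self _ (Real.smoothTransition.nonneg _))⟩

/-- The (shifted) V-fibre start-of-phase cone factor `g^S(t − t₀, n′)` takes values in `[0,1]`. [folklore] -/
theorem coneFactorV_mem (γ ε εa a L : ℝ) (n' : ℤ) (t₀ t : ℝ) :
    0 ≤ smoothTransition ((|t - t₀| - L) / (ε * L)) * (1 - smoothTransition ((γ * |(n' : ℝ)| - a * |t - t₀|) / (εa * L))) ∧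
    smoothTransition ((|t - t₀| - L) / (ε * L)) * (1 - smoothTransition ((γ * |(n' : ℝ)| - a * |t - t₀|) / (εa * L))) ≤ 1 :=
  ⟨mul_nonneg (Real.smoothTransition.nonneg _) (sub_nonneg.mpr (Real.smoothTransition.le_one _)),
    mul_le_one₀ (Real.smoothTransition.le_one _) (sub_nonneg.mpr (Real.smoothTransition.le_one _))
      (sub_le_self _ (Real.smoothTransition.nonneg _))⟩

/-- **The mid-phase factor along a V-fibre** `f(t) = g^M(t, n′)` (`ε, ε_a, a₂, L₀ > 0`): differentiable, and `∃ C ≥ 0`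
(absolute) with `|f′(t)| ≤ C/b` whenever `0 < b ≤ εL₀`, `b(γ² + a₂) ≤ ε_aL₀`, for every fibre `n′ ∈ ℤ`.
[cite: Grafakos2014, Prop. 3.1.2 (5)] -/
theorem exists_bound_deriv_midFactorV :
    ∃ C : ℝ, 0 ≤ C ∧ ∀ {γ ε εa a₂ L₀ b : ℝ}, 0 < ε → 0 < εa → 0 < a₂ → 0 < L₀ → 0 < b → b ≤ ε * L₀ →
      b * (γ ^ 2 + a₂) ≤ εa * L₀ → ∀ (n' : ℤ) (t : ℝ),
      DifferentiableAt ℝ (fun t : ℝ => smoothTransition ((|t| - L₀) / (ε * L₀)) *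
        (1 - smoothTransition ((γ * |(n' : ℝ) + γ * t| - a₂ * |t|) / (εa * L₀)) *
          smoothTransition ((γ * |(n' : ℝ) - γ * t| - a₂ * |t|) / (εa * L₀)))) t ∧
      |deriv (fun t : ℝ => smoothTransition ((|t| - L₀) / (ε * L₀)) *
        (1 - smoothTransition ((γ * |(n' : ℝ) + γ * t| - a₂ * |t|) / (εa * L₀)) *
          smoothTransition ((γ * |(n' : ℝ) - γ * t| - a₂ * |t|) / (εa * L₀)))) t| ≤ C / b := by
  obtain ⟨C, hC0, hC⟩ := exists_bound_iteratedDeriv_symM_fibreV 1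
  refine ⟨C, hC0, ?_⟩
  intro γ ε εa a₂ L₀ b hε hεa ha₂ hL₀ hb hb₁ hb₂ n' t
  have hP : ContDiff ℝ 1 (fun t : ℝ => 1 - smoothTransition ((|t| - L₀) / (ε * L₀)) *
      (1 - smoothTransition ((γ * |(n' : ℝ) + γ * t| - a₂ * |t|) / (εa * L₀)) *
        smoothTransition ((γ * |(n' : ℝ) - γ * t| - a₂ * |t|) / (εa * L₀)))) :=
    contDiff_symM_fibreV (γ := γ) hε hεa ha₂ hL₀ (n' : ℝ)
  have hPd : DifferentiableAt ℝ (fun t : ℝ => 1 - smoothTransition ((|t| - L₀) / (ε * L₀)) *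
      (1 - smoothTransition ((γ * |(n' : ℝ) + γ * t| - a₂ * |t|) / (εa * L₀)) *
        smoothTransition ((γ * |(n' : ℝ) - γ * t| - a₂ * |t|) / (εa * L₀)))) t := hP.differentiable (by simp) t
  have e : (fun t : ℝ => smoothTransition ((|t| - L₀) / (ε * L₀)) *
      (1 - smoothTransition ((γ * |(n' : ℝ) + γ * t| - a₂ * |t|) / (εa * L₀)) *
        smoothTransition ((γ * |(n' : ℝ) - γ * t| - a₂ * |t|) / (εa * L₀)))) = fun t => 1 - (1 -
      smoothTransition ((|t| - L₀) / (ε * L₀)) *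
      (1 - smoothTransition ((γ * |(n' : ℝ) + γ * t| - a₂ * |t|) / (εa * L₀)) *
        smoothTransition ((γ * |(n' : ℝ) - γ * t| - a₂ * |t|) / (εa * L₀)))) := by
    funext t; ring
  rw [e]
  refine ⟨hPd.const_sub 1, ?_⟩
  rw [deriv_const_sub, abs_neg]
  have h := hC hε hεa ha₂ hL₀ hb hb₁ hb₂ n' t
  rwa [iteratedDeriv_one, pow_one] at h

/-- **The envelope factor along a V-fibre** `g(t) = (1 − sT((|t − t₀| − R)/w))·(1 − sT((|n′| − R)/w))` (`R, w > 0`):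
differentiable, and `∃ C ≥ 0` (absolute) with `|g′(t)| ≤ C/b` whenever `0 < b ≤ w`. [cite: Grafakos2014, Prop. 3.1.2 (5)] -/
theorem exists_bound_deriv_envFactorV :
    ∃ C : ℝ, 0 ≤ C ∧ ∀ {R w b : ℝ}, 0 < R → 0 < w → 0 < b → b ≤ w → ∀ (n' : ℤ) (t₀ t : ℝ),
      DifferentiableAt ℝ (fun t : ℝ => (1 - smoothTransition ((|t - t₀| - R) / w)) *
        (1 - smoothTransition ((|(n' : ℝ)| - R) / w))) t ∧
      |deriv (fun t : ℝ => (1 - smoothTransition ((|t - t₀| - R) / w)) * (1 - smoothTransition ((|(n' : ℝ)| - R) / w))) t| ≤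
        C / b := by
  obtain ⟨C, hC0, hC⟩ := exists_bound_iteratedDeriv_envFactor 1
  refine ⟨C, hC0, ?_⟩
  intro R w b hR hw hb hbw n' t₀ t
  have hc0 : 0 ≤ 1 - smoothTransition ((|(n' : ℝ)| - R) / w) := sub_nonneg.mpr (Real.smoothTransition.le_one _)
  have hc1 : 1 - smoothTransition ((|(n' : ℝ)| - R) / w) ≤ 1 := sub_le_self _ (Real.smoothTransition.nonneg _)
  have e : (fun t : ℝ => (1 - smoothTransition ((|t - t₀| - R) / w)) * (1 - smoothTransition ((|(n' : ℝ)| - R) / w))) =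
      fun t : ℝ => (1 - smoothTransition ((|(n' : ℝ)| - R) / w)) * (1 - smoothTransition ((|t - t₀| - R) / w)) := by
    funext t; ring
  rw [e]
  refine ⟨(contDiff_envFactor hR hw _ t₀ (m := 1)).differentiable (by simp) t, ?_⟩
  have h := hC hc0 hc1 hR hw hb hbw t₀ t
  rwa [iteratedDeriv_one, pow_one] at h

/-- **The start-of-phase cone factor along a V-fibre, shifted** `f(t) = g^S(t − t₀, n′)` (`ε, ε_a, a, L > 0`):
differentiable, and `∃ C ≥ 0` (absolute) with `|f′(t)| ≤ C/b` whenever `0 < b ≤ εL`, `b·a ≤ ε_aL`, uniformly in the fibre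
`n′ ∈ ℤ` and the shift `t₀`. [cite: Grafakos2014, Prop. 3.1.2 (5)] -/
theorem exists_bound_deriv_coneFactorV :
    ∃ C : ℝ, 0 ≤ C ∧ ∀ {γ ε εa a L b : ℝ}, 0 < ε → 0 < εa → 0 < a → 0 < L → 0 < b → b ≤ ε * L → b * a ≤ εa * L →
      ∀ (n' : ℤ) (t₀ t : ℝ),
      DifferentiableAt ℝ (fun t : ℝ => smoothTransition ((|t - t₀| - L) / (ε * L)) *
        (1 - smoothTransition ((γ * |(n' : ℝ)| - a * |t - t₀|) / (εa * L)))) t ∧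
      |deriv (fun t : ℝ => smoothTransition ((|t - t₀| - L) / (ε * L)) *
        (1 - smoothTransition ((γ * |(n' : ℝ)| - a * |t - t₀|) / (εa * L)))) t| ≤ C / b := by
  obtain ⟨C, hC0, hC⟩ := exists_bound_iteratedDeriv_symS_fibreV 1
  refine ⟨C, hC0, ?_⟩
  intro γ ε εa a L b hε hεa ha hL hb hb₁ hb₂ n' t₀ t
  -- the unshifted profile `1 − g^S(·, n′)` and its shift
  have hP : ContDiff ℝ 1 (fun t : ℝ => 1 - smoothTransition ((|t| - L) / (ε * L)) *
      (1 - smoothTransition ((γ * |(n' : ℝ)| - a * |t|) / (εa * L)))) :=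
    contDiff_symS_fibreV (γ := γ) (a := a) hε hεa hL (n' : ℝ)
  have hPs : ContDiff ℝ 1 (fun t : ℝ => 1 - smoothTransition ((|t - t₀| - L) / (ε * L)) *
      (1 - smoothTransition ((γ * |(n' : ℝ)| - a * |t - t₀|) / (εa * L)))) :=
    hP.comp ((contDiff_id (𝕜 := ℝ) (E := ℝ)).sub (contDiff_const (c := t₀)))
  have hPd : DifferentiableAt ℝ (fun t : ℝ => 1 - smoothTransition ((|t - t₀| - L) / (ε * L)) *
      (1 - smoothTransition ((γ * |(n' : ℝ)| - a * |t - t₀|) / (εa * L)))) t := hPs.differentiable (by simp) t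
  have e : (fun t : ℝ => smoothTransition ((|t - t₀| - L) / (ε * L)) *
      (1 - smoothTransition ((γ * |(n' : ℝ)| - a * |t - t₀|) / (εa * L)))) = fun t => 1 - (1 -
      smoothTransition ((|t - t₀| - L) / (ε * L)) * (1 - smoothTransition ((γ * |(n' : ℝ)| - a * |t - t₀|) / (εa * L)))) := by
    funext t; ring
  rw [e]
  refine ⟨hPd.const_sub 1, ?_⟩
  rw [deriv_const_sub, abs_neg]
  have hshift : deriv (fun t : ℝ => 1 - smoothTransition ((|t - t₀| - L) / (ε * L)) *
      (1 - smoothTransition ((γ * |(n' : ℝ)| - a * |t - t₀|) / (εa * L)))) t =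
      iteratedDeriv 1 (fun t : ℝ => 1 - smoothTransition ((|t| - L) / (ε * L)) *
      (1 - smoothTransition ((γ * |(n' : ℝ)| - a * |t|) / (εa * L)))) (t - t₀) := by
    rw [← iteratedDeriv_one, iteratedDeriv_comp_sub_const 1 (fun t : ℝ => 1 - smoothTransition ((|t| - L) / (ε * L)) *
      (1 - smoothTransition ((γ * |(n' : ℝ)| - a * |t|) / (εa * L)))) t₀]
  rw [hshift]
  have h := hC (γ := γ) hε hεa ha hL hb hb₁ hb₂ (n' : ℝ) (t - t₀)
  rwa [pow_one] at h


/-! ## The old symbol `m̂ = 1 − g^M_{L₀}·g^env_{R,w}` on V-fibres -/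

/-- **First-order V-fibre data of `m̂`** (hypotheses `hMμc/hCμ` of `cascade_ledger_step_V'` at `r = 1`, with
`Mμ n′ t = 1 − g^M(t, n′)·g^env(t, n′)`): there is an absolute `C ≥ 0` such that for `ε, ε_a, a₂, L₀, R, w > 0` and every
scale `0 < b` with `b ≤ εL₀`, `b(γ² + a₂) ≤ ε_aL₀`, `b ≤ w`, each fibre profile is `C¹`, bounded by `1`, with `|Mμ′| ≤ C/b`.
[cite: Grafakos2014, Prop. 3.1.2 (5)] -/
theorem exists_fibre_data_symProdM_V :
    ∃ C : ℝ, 0 ≤ C ∧ ∀ {γ ε εa a₂ L₀ R w b : ℝ}, 0 < ε → 0 < εa → 0 < a₂ → 0 < L₀ → 0 < R → 0 < w → 0 < b →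
      b ≤ ε * L₀ → b * (γ ^ 2 + a₂) ≤ εa * L₀ → b ≤ w → ∀ n' : ℤ,
      ContDiff ℝ 1 (fun t : ℝ => 1 - smoothTransition ((|t| - L₀) / (ε * L₀)) *
          (1 - smoothTransition ((γ * |(n' : ℝ) + γ * t| - a₂ * |t|) / (εa * L₀)) *
            smoothTransition ((γ * |(n' : ℝ) - γ * t| - a₂ * |t|) / (εa * L₀))) *
          ((1 - smoothTransition ((|t| - R) / w)) * (1 - smoothTransition ((|(n' : ℝ)| - R) / w)))) ∧
      (∀ t : ℝ, |1 - smoothTransition ((|t| - L₀) / (ε * L₀)) *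
          (1 - smoothTransition ((γ * |(n' : ℝ) + γ * t| - a₂ * |t|) / (εa * L₀)) *
            smoothTransition ((γ * |(n' : ℝ) - γ * t| - a₂ * |t|) / (εa * L₀))) *
          ((1 - smoothTransition ((|t| - R) / w)) * (1 - smoothTransition ((|(n' : ℝ)| - R) / w)))| ≤ 1) ∧
      ∀ t : ℝ, |deriv (fun t : ℝ => 1 - smoothTransition ((|t| - L₀) / (ε * L₀)) *
          (1 - smoothTransition ((γ * |(n' : ℝ) + γ * t| - a₂ * |t|) / (εa * L₀)) *
            smoothTransition ((γ * |(n' : ℝ) - γ * t| - a₂ * |t|) / (εa * L₀))) *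
          ((1 - smoothTransition ((|t| - R) / w)) * (1 - smoothTransition ((|(n' : ℝ)| - R) / w)))) t| ≤ C / b := by
  obtain ⟨CM, hCM0, hCM⟩ := exists_bound_deriv_midFactorV
  obtain ⟨CE, hCE0, hCE⟩ := exists_bound_deriv_envFactorV
  refine ⟨CM + CE, by positivity, ?_⟩
  intro γ ε εa a₂ L₀ R w b hε hεa ha₂ hL₀ hR hw hb hb₁ hb₂ hbw n'
  have e : (fun t : ℝ => smoothTransition ((|t| - L₀) / (ε * L₀)) *
      (1 - smoothTransition ((γ * |(n' : ℝ) + γ * t| - a₂ * |t|) / (εa * L₀)) *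
        smoothTransition ((γ * |(n' : ℝ) - γ * t| - a₂ * |t|) / (εa * L₀)))) = fun t => 1 - (1 -
      smoothTransition ((|t| - L₀) / (ε * L₀)) *
      (1 - smoothTransition ((γ * |(n' : ℝ) + γ * t| - a₂ * |t|) / (εa * L₀)) *
        smoothTransition ((γ * |(n' : ℝ) - γ * t| - a₂ * |t|) / (εa * L₀)))) := by
    funext t; ring
  have hM : ContDiff ℝ 1 (fun t : ℝ => smoothTransition ((|t| - L₀) / (ε * L₀)) *
      (1 - smoothTransition ((γ * |(n' : ℝ) + γ * t| - a₂ * |t|) / (εa * L₀)) *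
        smoothTransition ((γ * |(n' : ℝ) - γ * t| - a₂ * |t|) / (εa * L₀)))) := by
    rw [e]; exact contDiff_const.sub (contDiff_symM_fibreV (γ := γ) hε hεa ha₂ hL₀ (n' : ℝ))
  have eE : (fun t : ℝ => (1 - smoothTransition ((|t| - R) / w)) * (1 - smoothTransition ((|(n' : ℝ)| - R) / w))) =
      fun t : ℝ => (1 - smoothTransition ((|(n' : ℝ)| - R) / w)) * (1 - smoothTransition ((|t - 0| - R) / w)) := by
    funext t; rw [sub_zero]; ring
  have hE : ContDiff ℝ 1 (fun t : ℝ => (1 - smoothTransition ((|t| - R) / w)) *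
      (1 - smoothTransition ((|(n' : ℝ)| - R) / w))) := by
    rw [eE]; exact contDiff_envFactor hR hw (1 - smoothTransition ((|(n' : ℝ)| - R) / w)) 0
  refine ⟨contDiff_const.sub (hM.mul hE), fun t => ?_, fun t => ?_⟩
  · have hEm := envFactorV_mem R w n' 0 t
    simp only [sub_zero] at hEm
    obtain ⟨h0, h1⟩ := one_sub_mul_mem (midFactorV_mem γ ε εa a₂ L₀ n' t).1 (midFactorV_mem γ ε εa a₂ L₀ n' t).2
      hEm.1 hEm.2
    rw [abs_of_nonneg h0]; exact h1
  · obtain ⟨hdM, hM'⟩ := hCM (γ := γ) hε hεa ha₂ hL₀ hb hb₁ hb₂ n' t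
    have hEt := hCE hR hw hb hbw n' 0 t
    simp only [sub_zero] at hEt
    obtain ⟨hdE, hE'⟩ := hEt
    have hM1' : |smoothTransition ((|t| - L₀) / (ε * L₀)) *
        (1 - smoothTransition ((γ * |(n' : ℝ) + γ * t| - a₂ * |t|) / (εa * L₀)) *
          smoothTransition ((γ * |(n' : ℝ) - γ * t| - a₂ * |t|) / (εa * L₀)))| ≤ 1 := by
      rw [abs_of_nonneg (midFactorV_mem γ ε εa a₂ L₀ n' t).1]; exact (midFactorV_mem γ ε εa a₂ L₀ n' t).2
    have hE1' : |(1 - smoothTransition ((|t| - R) / w)) * (1 - smoothTransition ((|(n' : ℝ)| - R) / w))| ≤ 1 := by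
      have h := envFactorV_mem R w n' 0 t
      simp only [sub_zero] at h
      rw [abs_of_nonneg h.1]; exact h.2
    rw [add_div]
    exact abs_deriv_one_sub_mul_le hdM hdE hM1' hE1' hM' hE'

/-- **Lipschitz bound of `m̂` along the `e_h`-axis** (input `hLip` of `…SpectralMoments.modulus_of_fibre_lipschitz` with
`j := 0`, yielding `hω0/hω` of `cascade_ledger_step_V'` with `wd(q) = (C/b)|q_h|` on the axis and `2` off it): with the
constant of `exists_fibre_data_symProdM_V`, `|m̂(k) − m̂(k − q)| ≤ (C/b)|q_h|` for `q ∈ ℤe_h`. [cite: Grafakos2014, Prop. 3.1.2 (5)] -/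
theorem exists_lipschitz_axis_symProdM_V :
    ∃ C : ℝ, 0 ≤ C ∧ ∀ {γ ε εa a₂ L₀ R w b : ℝ}, 0 < ε → 0 < εa → 0 < a₂ → 0 < L₀ → 0 < R → 0 < w → 0 < b →
      b ≤ ε * L₀ → b * (γ ^ 2 + a₂) ≤ εa * L₀ → b ≤ w → ∀ k q : Fin 2 → ℤ, (∀ l : Fin 2, l ≠ 0 → q l = 0) →
        |(1 - smoothTransition ((|(k 0 : ℝ)| - L₀) / (ε * L₀)) *
              (1 - smoothTransition ((γ * |(k 1 : ℝ) + γ * (k 0)| - a₂ * |(k 0 : ℝ)|) / (εa * L₀)) *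
                smoothTransition ((γ * |(k 1 : ℝ) - γ * (k 0)| - a₂ * |(k 0 : ℝ)|) / (εa * L₀))) *
              ((1 - smoothTransition ((|(k 0 : ℝ)| - R) / w)) * (1 - smoothTransition ((|(k 1 : ℝ)| - R) / w)))) -
          (1 - smoothTransition ((|((k - q) 0 : ℝ)| - L₀) / (ε * L₀)) *
              (1 - smoothTransition ((γ * |((k - q) 1 : ℝ) + γ * ((k - q) 0)| - a₂ * |((k - q) 0 : ℝ)|) / (εa * L₀)) *
                smoothTransition ((γ * |((k - q) 1 : ℝ) - γ * ((k - q) 0)| - a₂ * |((k - q) 0 : ℝ)|) / (εa * L₀))) *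
              ((1 - smoothTransition ((|((k - q) 0 : ℝ)| - R) / w)) *
                (1 - smoothTransition ((|((k - q) 1 : ℝ)| - R) / w))))| ≤ C / b * |(q 0 : ℝ)| := by
  obtain ⟨C, hC0, hC⟩ := exists_fibre_data_symProdM_V
  refine ⟨C, hC0, ?_⟩
  intro γ ε εa a₂ L₀ R w b hε hεa ha₂ hL₀ hR hw hb hb₁ hb₂ hbw k q hq
  set Mf : (Fin 2 → ℤ) → ℝ → ℝ := fun k t =>
    1 - smoothTransition ((|t| - L₀) / (ε * L₀)) *
      (1 - smoothTransition ((γ * |(k 1 : ℝ) + γ * t| - a₂ * |t|) / (εa * L₀)) *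
        smoothTransition ((γ * |(k 1 : ℝ) - γ * t| - a₂ * |t|) / (εa * L₀))) *
      ((1 - smoothTransition ((|t| - R) / w)) * (1 - smoothTransition ((|(k 1 : ℝ)| - R) / w))) with hMf
  have hdiff : ∀ k, Differentiable ℝ (Mf k) := fun k =>
    (hC (γ := γ) hε hεa ha₂ hL₀ hR hw hb hb₁ hb₂ hbw (k 1)).1.differentiable (by simp)
  have hder : ∀ k t, |deriv (Mf k) t| ≤ C / b := fun k t => (hC (γ := γ) hε hεa ha₂ hL₀ hR hw hb hb₁ hb₂ hbw (k 1)).2.2 t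
  refine abs_sub_le_of_fibre_deriv (μ := fun k : Fin 2 → ℤ =>
    1 - smoothTransition ((|(k 0 : ℝ)| - L₀) / (ε * L₀)) *
      (1 - smoothTransition ((γ * |(k 1 : ℝ) + γ * (k 0)| - a₂ * |(k 0 : ℝ)|) / (εa * L₀)) *
        smoothTransition ((γ * |(k 1 : ℝ) - γ * (k 0)| - a₂ * |(k 0 : ℝ)|) / (εa * L₀))) *
      ((1 - smoothTransition ((|(k 0 : ℝ)| - R) / w)) * (1 - smoothTransition ((|(k 1 : ℝ)| - R) / w))))
    (0 : Fin 2) (Mf := Mf) hdiff hder ?_ k q hq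
  intro k q hq
  obtain ⟨h1, h0⟩ := sub_apply_of_axis_zero k q hq
  simp only [hMf, h0, h1]

/-! ## The new symbol `μ̂′ = 1 − g^S_{L}·g^env_{R′,w′}` on V-fibres: the shifted squares -/

/-- **First-order V-fibre data of the shifted squares of `μ̂′`** (hypotheses `hNpc/hNmc/hCNp/hCNm` at `r = 1`, with
`N n′ t = (1 − g^S(t − t₀, n′)·g^env(t − t₀, n′))²`, `t₀ = b^±_{n′}`): there is an absolute `C ≥ 0` such that for
`ε, ε_a, a, L, R, w > 0` and every `0 < b` with `b ≤ εL`, `b·a ≤ ε_aL`, `b ≤ w`, each profile is `C¹`, bounded by `1`, with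
`|N′| ≤ C/b`, uniformly in the fibre `n′` and the shift `t₀`. [cite: Grafakos2014, Prop. 3.1.2 (5)] -/
theorem exists_fibre_data_symProdS_V_sq :
    ∃ C : ℝ, 0 ≤ C ∧ ∀ {γ ε εa a L R w b : ℝ}, 0 < ε → 0 < εa → 0 < a → 0 < L → 0 < R → 0 < w → 0 < b →
      b ≤ ε * L → b * a ≤ εa * L → b ≤ w → ∀ (n' : ℤ) (t₀ : ℝ),
      ContDiff ℝ 1 (fun t : ℝ => (1 - smoothTransition ((|t - t₀| - L) / (ε * L)) *
          (1 - smoothTransition ((γ * |(n' : ℝ)| - a * |t - t₀|) / (εa * L))) *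
          ((1 - smoothTransition ((|t - t₀| - R) / w)) * (1 - smoothTransition ((|(n' : ℝ)| - R) / w)))) ^ 2) ∧
      (∀ t : ℝ, |(1 - smoothTransition ((|t - t₀| - L) / (ε * L)) *
          (1 - smoothTransition ((γ * |(n' : ℝ)| - a * |t - t₀|) / (εa * L))) *
          ((1 - smoothTransition ((|t - t₀| - R) / w)) * (1 - smoothTransition ((|(n' : ℝ)| - R) / w)))) ^ 2| ≤ 1) ∧
      ∀ t : ℝ, |deriv (fun t : ℝ => (1 - smoothTransition ((|t - t₀| - L) / (ε * L)) *
          (1 - smoothTransition ((γ * |(n' : ℝ)| - a * |t - t₀|) / (εa * L))) *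
          ((1 - smoothTransition ((|t - t₀| - R) / w)) * (1 - smoothTransition ((|(n' : ℝ)| - R) / w)))) ^ 2) t| ≤
        C / b := by
  obtain ⟨CS, hCS0, hCS⟩ := exists_bound_deriv_coneFactorV
  obtain ⟨CE, hCE0, hCE⟩ := exists_bound_deriv_envFactorV
  refine ⟨2 * (CS + CE), by positivity, ?_⟩
  intro γ ε εa a L R w b hε hεa ha hL hR hw hb hb₁ hb₂ hbw n' t₀
  have e : (fun t : ℝ => smoothTransition ((|t - t₀| - L) / (ε * L)) *
      (1 - smoothTransition ((γ * |(n' : ℝ)| - a * |t - t₀|) / (εa * L)))) = fun t => 1 - (1 -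
      smoothTransition ((|t - t₀| - L) / (ε * L)) * (1 - smoothTransition ((γ * |(n' : ℝ)| - a * |t - t₀|) / (εa * L)))) := by
    funext t; ring
  have hS : ContDiff ℝ 1 (fun t : ℝ => smoothTransition ((|t - t₀| - L) / (ε * L)) *
      (1 - smoothTransition ((γ * |(n' : ℝ)| - a * |t - t₀|) / (εa * L)))) := by
    rw [e]
    exact contDiff_const.sub ((contDiff_symS_fibreV (γ := γ) (a := a) hε hεa hL (n' : ℝ)).comp
      ((contDiff_id (𝕜 := ℝ) (E := ℝ)).sub (contDiff_const (c := t₀))))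
  have eE : (fun t : ℝ => (1 - smoothTransition ((|t - t₀| - R) / w)) * (1 - smoothTransition ((|(n' : ℝ)| - R) / w))) =
      fun t : ℝ => (1 - smoothTransition ((|(n' : ℝ)| - R) / w)) * (1 - smoothTransition ((|t - t₀| - R) / w)) := by
    funext t; ring
  have hE : ContDiff ℝ 1 (fun t : ℝ => (1 - smoothTransition ((|t - t₀| - R) / w)) *
      (1 - smoothTransition ((|(n' : ℝ)| - R) / w))) := by
    rw [eE]; exact contDiff_envFactor hR hw (1 - smoothTransition ((|(n' : ℝ)| - R) / w)) t₀
  refine ⟨(contDiff_const.sub (hS.mul hE)).pow 2, fun t => ?_, fun t => ?_⟩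
  · obtain ⟨h0, h1⟩ := one_sub_mul_mem (coneFactorV_mem γ ε εa a L n' t₀ t).1 (coneFactorV_mem γ ε εa a L n' t₀ t).2
      (envFactorV_mem R w n' t₀ t).1 (envFactorV_mem R w n' t₀ t).2
    rw [abs_of_nonneg (sq_nonneg _)]; exact pow_le_one₀ h0 h1
  · obtain ⟨hdS, hS'⟩ := hCS (γ := γ) hε hεa ha hL hb hb₁ hb₂ n' t₀ t
    obtain ⟨hdE, hE'⟩ := hCE hR hw hb hbw n' t₀ t
    have h2 : 2 * (CS + CE) / b = 2 * (CS / b + CE / b) := by ring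
    rw [h2]
    exact abs_deriv_one_sub_mul_sq_le hdS hdE (coneFactorV_mem γ ε εa a L n' t₀ t).1 (coneFactorV_mem γ ε εa a L n' t₀ t).2
      (envFactorV_mem R w n' t₀ t).1 (envFactorV_mem R w n' t₀ t).2 hS' hE'

/-- **Lipschitz bound of `μ̂′²` along the `e_h`-axis** (input of `modulus_of_fibre_lipschitz` with `j := 0` for `hω20/hω2` of
`cascade_ledger_step_V'`, giving `wd₂(q) = (C/b)|q_h|` on the axis and `2` off it), with the constant of
`exists_fibre_data_symProdS_V_sq`. [cite: Grafakos2014, Prop. 3.1.2 (5)] -/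
theorem exists_lipschitz_axis_symProdS_V_sq :
    ∃ C : ℝ, 0 ≤ C ∧ ∀ {γ ε εa a L R w b : ℝ}, 0 < ε → 0 < εa → 0 < a → 0 < L → 0 < R → 0 < w → 0 < b →
      b ≤ ε * L → b * a ≤ εa * L → b ≤ w → ∀ k q : Fin 2 → ℤ, (∀ l : Fin 2, l ≠ 0 → q l = 0) →
        |(1 - smoothTransition ((|(k 0 : ℝ)| - L) / (ε * L)) * (1 - smoothTransition ((γ * |(k 1 : ℝ)| - a * |(k 0 : ℝ)|) / (εa * L))) *
              ((1 - smoothTransition ((|(k 0 : ℝ)| - R) / w)) * (1 - smoothTransition ((|(k 1 : ℝ)| - R) / w)))) ^ 2 -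
          (1 - smoothTransition ((|((k - q) 0 : ℝ)| - L) / (ε * L)) *
              (1 - smoothTransition ((γ * |((k - q) 1 : ℝ)| - a * |((k - q) 0 : ℝ)|) / (εa * L))) *
              ((1 - smoothTransition ((|((k - q) 0 : ℝ)| - R) / w)) *
                (1 - smoothTransition ((|((k - q) 1 : ℝ)| - R) / w)))) ^ 2| ≤ C / b * |(q 0 : ℝ)| := by
  obtain ⟨C, hC0, hC⟩ := exists_fibre_data_symProdS_V_sq
  refine ⟨C, hC0, ?_⟩
  intro γ ε εa a L R w b hε hεa ha hL hR hw hb hb₁ hb₂ hbw k q hq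
  set Mf : (Fin 2 → ℤ) → ℝ → ℝ := fun k t =>
    (1 - smoothTransition ((|t - 0| - L) / (ε * L)) * (1 - smoothTransition ((γ * |(k 1 : ℝ)| - a * |t - 0|) / (εa * L))) *
      ((1 - smoothTransition ((|t - 0| - R) / w)) * (1 - smoothTransition ((|(k 1 : ℝ)| - R) / w)))) ^ 2 with hMf
  have hdiff : ∀ k, Differentiable ℝ (Mf k) := fun k =>
    (hC (γ := γ) hε hεa ha hL hR hw hb hb₁ hb₂ hbw (k 1) 0).1.differentiable (by simp)
  have hder : ∀ k t, |deriv (Mf k) t| ≤ C / b := fun k t =>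
    (hC (γ := γ) hε hεa ha hL hR hw hb hb₁ hb₂ hbw (k 1) 0).2.2 t
  refine abs_sub_le_of_fibre_deriv (μ := fun k : Fin 2 → ℤ =>
    (1 - smoothTransition ((|(k 0 : ℝ)| - L) / (ε * L)) * (1 - smoothTransition ((γ * |(k 1 : ℝ)| - a * |(k 0 : ℝ)|) / (εa * L))) *
      ((1 - smoothTransition ((|(k 0 : ℝ)| - R) / w)) * (1 - smoothTransition ((|(k 1 : ℝ)| - R) / w)))) ^ 2)
    (0 : Fin 2) (Mf := Mf) hdiff hder ?_ k q hq
  intro k q hq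
  obtain ⟨h1, h0⟩ := sub_apply_of_axis_zero k q hq
  simp only [hMf, h0, h1, sub_zero]

/-- **The shift identity `hmNp/hmNm` on the V half-slot**: with `mf n′ k = μ̂′(k_h, n′)` and `N n′ t` the shifted squared
V-fibre profile of `exists_fibre_data_symProdS_V_sq` at `t₀ = b`, `mf n′ (k − b·e_h)² = N n′ (k_h)`. [folklore] -/
theorem symProdS_sub_single_zero_sq_eq (γ ε εa a L R w : ℝ) (n' b : ℤ) (k : Fin 2 → ℤ) :
    (1 - smoothTransition ((|(((k - Pi.single (0 : Fin 2) b : Fin 2 → ℤ) 0 : ℤ) : ℝ)| - L) / (ε * L)) *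
        (1 - smoothTransition ((γ * |(n' : ℝ)| - a * |(((k - Pi.single (0 : Fin 2) b : Fin 2 → ℤ) 0 : ℤ) : ℝ)|) /
          (εa * L))) *
        ((1 - smoothTransition ((|(((k - Pi.single (0 : Fin 2) b : Fin 2 → ℤ) 0 : ℤ) : ℝ)| - R) / w)) *
          (1 - smoothTransition ((|(n' : ℝ)| - R) / w)))) ^ 2 =
      (1 - smoothTransition ((|(k 0 : ℝ) - b| - L) / (ε * L)) *
        (1 - smoothTransition ((γ * |(n' : ℝ)| - a * |(k 0 : ℝ) - b|) / (εa * L))) *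
        ((1 - smoothTransition ((|(k 0 : ℝ) - b| - R) / w)) * (1 - smoothTransition ((|(n' : ℝ)| - R) / w)))) ^ 2 := by
  have h : (((k - Pi.single (0 : Fin 2) b : Fin 2 → ℤ) 0 : ℤ) : ℝ) = (k 0 : ℝ) - (b : ℝ) := by
    rw [(sub_single_zero_apply k b).1]; push_cast; ring
  rw [h]

/-- **The fibre identity `hμM`/`hmf` on the V half-slot** is definitional: on the fibre `k_v = n′` the lattice symbol IS
its V-fibre profile at `t = k_h` (recorded for the old symbol; used with `subst`). [folklore] -/
theorem symProdM_fibre_eq_V (γ ε εa a₂ L₀ R w : ℝ) (n' : ℤ) (k : Fin 2 → ℤ) (hk : k 1 = n') :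
    1 - smoothTransition ((|(k 0 : ℝ)| - L₀) / (ε * L₀)) *
          (1 - smoothTransition ((γ * |(k 1 : ℝ) + γ * (k 0)| - a₂ * |(k 0 : ℝ)|) / (εa * L₀)) *
            smoothTransition ((γ * |(k 1 : ℝ) - γ * (k 0)| - a₂ * |(k 0 : ℝ)|) / (εa * L₀))) *
          ((1 - smoothTransition ((|(k 0 : ℝ)| - R) / w)) * (1 - smoothTransition ((|(k 1 : ℝ)| - R) / w))) =
      1 - smoothTransition ((|(k 0 : ℝ)| - L₀) / (ε * L₀)) *
          (1 - smoothTransition ((γ * |(n' : ℝ) + γ * (k 0)| - a₂ * |(k 0 : ℝ)|) / (εa * L₀)) *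
            smoothTransition ((γ * |(n' : ℝ) - γ * (k 0)| - a₂ * |(k 0 : ℝ)|) / (εa * L₀))) *
          ((1 - smoothTransition ((|(k 0 : ℝ)| - R) / w)) * (1 - smoothTransition ((|(n' : ℝ)| - R) / w))) := by
  rw [hk]

end Summit.AnomalousDissipation.AnomalousDissipation.Theorems.SawtoothPulseCascade.K1Symbol
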